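import Mathlib
import Summits.Ventures.PercRepro2.TypedClosed

/-!
# Two typed edges at `o`, I: the kernel and state lemmas (blind cell PercRepro2, night-3 g16,
2026-08-27; the algebraic form of NIGHT3-CERT.md §24.4)

Every term of the kernel `K₃` of (HCOV) reads the mark `o` in exactly one copy (`KB_killO` of
`TypedPendant.lean`).  Hence, when `o` is attached in two DIFFERENT copies (one attachment each)
and isolated in the third, the kernel is the SUM of the two single-attachment kernels
(`KB_mixed12` / `KB_mixed13` / `KB_mixed23` on states).  With two typed edges `e = {o, u}`,
`f = {o, v}` at `o` and every other edge at `o` closed, closing one of them with the other closed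
isolates `o` (`st_two_closed_e` / `st_two_closed_f`, from `st_update_closed_o`), so on such
configurations the six MIXED colourings of `(e, f)` (`e` in copy `i`, `f` in copy `j ≠ i`) satisfy
`K₃(mixed) = K₃(e alone in copy i) + K₃(f alone in copy j)` (`K3_mixed12` … `K3_mixed32`).
`TypedTwoEdgesAtO.lean` turns this into the deletion–contraction identity of the typed count.
Own work; standard axioms.
-/

namespace Summit.Ventures.PercRepro2

namespace CovForm

namespace TypedRed

open OneTyped

/-! ## The kernel identity for one attachment per copy -/

section Kernel

/-- `KOx` reads `o` only in its first argument. -/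
lemma KOx_killO_y (x y z : St) : KOx x (killO y) z = KOx x y z := rfl
/-- `KOx` reads `o` only in its first argument. -/
lemma KOx_killO_z (x y z : St) : KOx x y (killO z) = KOx x y z := rfl
/-- `KOy` reads `o` only in its second argument. -/
lemma KOy_killO_x (x y z : St) : KOy (killO x) y z = KOy x y z := rfl
/-- `KOy` reads `o` only in its second argument. -/
lemma KOy_killO_z (x y z : St) : KOy x y (killO z) = KOy x y z := rfl
/-- `KOz` reads `o` only in its third argument. -/
lemma KOz_killO_x (x y z : St) : KOz (killO x) y z = KOz x y z := rfl
/-- `KOz` reads `o` only in its third argument. -/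
lemma KOz_killO_y (x y z : St) : KOz x (killO y) z = KOz x y z := rfl

/-- **One attachment per copy is additive**: with `o` attached in copy `1` (state `x`) and in copy
`2` (state `y`, any attachment) and isolated in copy `3`, the kernel is the sum of the two
single-attachment kernels (`o` isolated in the other copies). -/
lemma KB_mixed12 (x y z : St) :
    KB x y (killO z) = KB x (killO y) (killO z) + KB (killO x) y (killO z) := by
  have h1 := KB_killO true true false x y z
  have h2 := KB_killO true false false x y z
  have h3 := KB_killO false true false x y z
  simp only [cond_true, cond_false, if_true, Bool.false_eq_true, if_false, add_zero, zero_add] at h1 h2 h3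
  rw [h1, h2, h3]

/-- The same with copies `1` and `3` attached. -/
lemma KB_mixed13 (x y z : St) :
    KB x (killO y) z = KB x (killO y) (killO z) + KB (killO x) (killO y) z := by
  have h1 := KB_killO true false true x y z
  have h2 := KB_killO true false false x y z
  have h3 := KB_killO false false true x y z
  simp only [cond_true, cond_false, if_true, Bool.false_eq_true, if_false, add_zero, zero_add] at h1 h2 h3
  rw [h1, h2, h3]

/-- The same with copies `2` and `3` attached. -/
lemma KB_mixed23 (x y z : St) :
    KB (killO x) y z = KB (killO x) y (killO z) + KB (killO x) (killO y) z := by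
  have h1 := KB_killO false true true x y z
  have h2 := KB_killO false true false x y z
  have h3 := KB_killO false false true x y z
  simp only [cond_true, cond_false, if_true, Bool.false_eq_true, if_false, add_zero, zero_add] at h1 h2 h3
  rw [h1, h2, h3]

end Kernel

/-! ## The Bool³ sum for type `1` -/

section Sums

variable {R : Type*} [CommRing R]

/-- `Σ_{(a,b,c) ∈ Bool³, a+b+c = 1} T a b c = T 1 0 0 + T 0 1 0 + T 0 0 1`. -/
lemma sum_bool3_one (T : Bool → Bool → Bool → R) :
    (∑ a : Bool, ∑ b : Bool, ∑ c : Bool, if a.toNat + b.toNat + c.toNat = 1 then T a b c else 0) =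
      T true false false + T false true false + T false false true := by
  simp only [Fintype.sum_bool, Bool.toNat_true, Bool.toNat_false]
  norm_num
  ring

end Sums


/-! ## States at two edges at `o` whose other edges are closed -/

section States

open Classical

variable {V : Type*} {E : Type*} [DecidableEq E]

variable (ends : E → Sym2 V) (o a₁ a₂ a₃ b : V)

/-- With `f` closed and every other edge at `o` closed, closing `e = {o, u}` isolates `o`. -/
lemma st_two_closed_e {e f : E} {u : V} (he : ends e = s(o, u)) (hou : o ≠ u) (hef : e ≠ f)
    (ho1 : o ≠ a₁) (ho2 : o ≠ a₂) (ho3 : o ≠ a₃) (hob : o ≠ b) {x : Config E}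
    (hx : ∀ e', e' ≠ e → e' ≠ f → o ∈ ends e' → x e' = false) :
    st ends o a₁ a₂ a₃ b (Function.update (Function.update x f false) e false) =
      killO (st ends o a₁ a₂ a₃ b (Function.update (Function.update x f false) e true)) := by
  refine st_update_closed_o ends o a₁ a₂ a₃ b he hou ho1 ho2 ho3 hob fun e' he' ho => ?_
  by_cases hf' : e' = f
  · subst hf'; exact Function.update_self _ _ _
  · rw [Function.update_of_ne hf']; exact hx e' he' hf' ho

/-- With `e` closed and every other edge at `o` closed, closing `f = {o, v}` isolates `o`. -/
lemma st_two_closed_f {e f : E} {v : V} (hf : ends f = s(o, v)) (hov : o ≠ v) (hef : e ≠ f)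
    (ho1 : o ≠ a₁) (ho2 : o ≠ a₂) (ho3 : o ≠ a₃) (hob : o ≠ b) {x : Config E}
    (hx : ∀ e', e' ≠ e → e' ≠ f → o ∈ ends e' → x e' = false) :
    st ends o a₁ a₂ a₃ b (Function.update (Function.update x f false) e false) =
      killO (st ends o a₁ a₂ a₃ b (Function.update (Function.update x f true) e false)) := by
  have h := st_update_closed_o ends o a₁ a₂ a₃ b hf hov ho1 ho2 ho3 hob
    (ω := Function.update x e false) fun e' he' ho => by
      by_cases he'' : e' = e
      · subst he''; exact Function.update_self _ _ _
      · rw [Function.update_of_ne he'']; exact hx e' he'' he' ho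
  rw [Function.update_comm hef.symm, Function.update_comm hef.symm]
  exact h

end States

/-! ## The mixed colourings on the support -/

section Mixed

open Classical

variable {V : Type*} {E : Type*} [DecidableEq E] {R : Type*} [Field R]

variable (ends : E → Sym2 V) (o a₁ a₂ a₃ b : V)

/-- **The mixed colourings are additive** (copies `1` and `2`): `e` in copy `1`, `f` in copy `2`. -/
lemma K3_mixed12 {e f : E} {u v : V} (he : ends e = s(o, u)) (hf : ends f = s(o, v))
    (hou : o ≠ u) (hov : o ≠ v) (hef : e ≠ f) (ho1 : o ≠ a₁) (ho2 : o ≠ a₂) (ho3 : o ≠ a₃)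
    (hob : o ≠ b) {x y w : Config E}
    (hx : ∀ e', e' ≠ e → e' ≠ f → o ∈ ends e' → x e' = false)
    (hy : ∀ e', e' ≠ e → e' ≠ f → o ∈ ends e' → y e' = false)
    (hw : ∀ e', e' ≠ e → e' ≠ f → o ∈ ends e' → w e' = false) :
    (K3 ends o a₁ a₂ a₃ b (Function.update (Function.update x f false) e true) (Function.update (Function.update y f true) e false) (Function.update (Function.update w f false) e false) : R) =
      K3 ends o a₁ a₂ a₃ b (Function.update (Function.update x f false) e true) (Function.update (Function.update y f false) e false) (Function.update (Function.update w f false) e false) +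
      K3 ends o a₁ a₂ a₃ b (Function.update (Function.update x f false) e false) (Function.update (Function.update y f true) e false) (Function.update (Function.update w f false) e false) := by
  simp only [K3_eq_KB]
  rw [st_two_closed_e ends o a₁ a₂ a₃ b he hou hef ho1 ho2 ho3 hob hw,
    st_two_closed_e ends o a₁ a₂ a₃ b he hou hef ho1 ho2 ho3 hob hx,
    st_two_closed_f ends o a₁ a₂ a₃ b hf hov hef ho1 ho2 ho3 hob hy]
  rw [KB_mixed12]
  push_cast
  ring

/-- `e` in copy `1`, `f` in copy `3`. -/
lemma K3_mixed13 {e f : E} {u v : V} (he : ends e = s(o, u)) (hf : ends f = s(o, v))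
    (hou : o ≠ u) (hov : o ≠ v) (hef : e ≠ f) (ho1 : o ≠ a₁) (ho2 : o ≠ a₂) (ho3 : o ≠ a₃)
    (hob : o ≠ b) {x y w : Config E}
    (hx : ∀ e', e' ≠ e → e' ≠ f → o ∈ ends e' → x e' = false)
    (hy : ∀ e', e' ≠ e → e' ≠ f → o ∈ ends e' → y e' = false)
    (hw : ∀ e', e' ≠ e → e' ≠ f → o ∈ ends e' → w e' = false) :
    (K3 ends o a₁ a₂ a₃ b (Function.update (Function.update x f false) e true) (Function.update (Function.update y f false) e false) (Function.update (Function.update w f true) e false) : R) =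
      K3 ends o a₁ a₂ a₃ b (Function.update (Function.update x f false) e true) (Function.update (Function.update y f false) e false) (Function.update (Function.update w f false) e false) +
      K3 ends o a₁ a₂ a₃ b (Function.update (Function.update x f false) e false) (Function.update (Function.update y f false) e false) (Function.update (Function.update w f true) e false) := by
  simp only [K3_eq_KB]
  rw [st_two_closed_e ends o a₁ a₂ a₃ b he hou hef ho1 ho2 ho3 hob hy,
    st_two_closed_e ends o a₁ a₂ a₃ b he hou hef ho1 ho2 ho3 hob hx,
    st_two_closed_f ends o a₁ a₂ a₃ b hf hov hef ho1 ho2 ho3 hob hw]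
  rw [KB_mixed13]
  push_cast
  ring

/-- `e` in copy `2`, `f` in copy `1`. -/
lemma K3_mixed21 {e f : E} {u v : V} (he : ends e = s(o, u)) (hf : ends f = s(o, v))
    (hou : o ≠ u) (hov : o ≠ v) (hef : e ≠ f) (ho1 : o ≠ a₁) (ho2 : o ≠ a₂) (ho3 : o ≠ a₃)
    (hob : o ≠ b) {x y w : Config E}
    (hx : ∀ e', e' ≠ e → e' ≠ f → o ∈ ends e' → x e' = false)
    (hy : ∀ e', e' ≠ e → e' ≠ f → o ∈ ends e' → y e' = false)
    (hw : ∀ e', e' ≠ e → e' ≠ f → o ∈ ends e' → w e' = false) :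
    (K3 ends o a₁ a₂ a₃ b (Function.update (Function.update x f true) e false) (Function.update (Function.update y f false) e true) (Function.update (Function.update w f false) e false) : R) =
      K3 ends o a₁ a₂ a₃ b (Function.update (Function.update x f false) e false) (Function.update (Function.update y f false) e true) (Function.update (Function.update w f false) e false) +
      K3 ends o a₁ a₂ a₃ b (Function.update (Function.update x f true) e false) (Function.update (Function.update y f false) e false) (Function.update (Function.update w f false) e false) := by
  simp only [K3_eq_KB]
  rw [st_two_closed_e ends o a₁ a₂ a₃ b he hou hef ho1 ho2 ho3 hob hw,
    st_two_closed_e ends o a₁ a₂ a₃ b he hou hef ho1 ho2 ho3 hob hy,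
    st_two_closed_f ends o a₁ a₂ a₃ b hf hov hef ho1 ho2 ho3 hob hx]
  rw [KB_mixed12]
  push_cast
  ring

/-- `e` in copy `2`, `f` in copy `3`. -/
lemma K3_mixed23 {e f : E} {u v : V} (he : ends e = s(o, u)) (hf : ends f = s(o, v))
    (hou : o ≠ u) (hov : o ≠ v) (hef : e ≠ f) (ho1 : o ≠ a₁) (ho2 : o ≠ a₂) (ho3 : o ≠ a₃)
    (hob : o ≠ b) {x y w : Config E}
    (hx : ∀ e', e' ≠ e → e' ≠ f → o ∈ ends e' → x e' = false)
    (hy : ∀ e', e' ≠ e → e' ≠ f → o ∈ ends e' → y e' = false)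
    (hw : ∀ e', e' ≠ e → e' ≠ f → o ∈ ends e' → w e' = false) :
    (K3 ends o a₁ a₂ a₃ b (Function.update (Function.update x f false) e false) (Function.update (Function.update y f false) e true) (Function.update (Function.update w f true) e false) : R) =
      K3 ends o a₁ a₂ a₃ b (Function.update (Function.update x f false) e false) (Function.update (Function.update y f false) e true) (Function.update (Function.update w f false) e false) +
      K3 ends o a₁ a₂ a₃ b (Function.update (Function.update x f false) e false) (Function.update (Function.update y f false) e false) (Function.update (Function.update w f true) e false) := by
  simp only [K3_eq_KB]
  rw [st_two_closed_e ends o a₁ a₂ a₃ b he hou hef ho1 ho2 ho3 hob hx,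
    st_two_closed_e ends o a₁ a₂ a₃ b he hou hef ho1 ho2 ho3 hob hy,
    st_two_closed_f ends o a₁ a₂ a₃ b hf hov hef ho1 ho2 ho3 hob hw]
  rw [KB_mixed23]
  push_cast
  ring

/-- `e` in copy `3`, `f` in copy `1`. -/
lemma K3_mixed31 {e f : E} {u v : V} (he : ends e = s(o, u)) (hf : ends f = s(o, v))
    (hou : o ≠ u) (hov : o ≠ v) (hef : e ≠ f) (ho1 : o ≠ a₁) (ho2 : o ≠ a₂) (ho3 : o ≠ a₃)
    (hob : o ≠ b) {x y w : Config E}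
    (hx : ∀ e', e' ≠ e → e' ≠ f → o ∈ ends e' → x e' = false)
    (hy : ∀ e', e' ≠ e → e' ≠ f → o ∈ ends e' → y e' = false)
    (hw : ∀ e', e' ≠ e → e' ≠ f → o ∈ ends e' → w e' = false) :
    (K3 ends o a₁ a₂ a₃ b (Function.update (Function.update x f true) e false) (Function.update (Function.update y f false) e false) (Function.update (Function.update w f false) e true) : R) =
      K3 ends o a₁ a₂ a₃ b (Function.update (Function.update x f false) e false) (Function.update (Function.update y f false) e false) (Function.update (Function.update w f false) e true) +
      K3 ends o a₁ a₂ a₃ b (Function.update (Function.update x f true) e false) (Function.update (Function.update y f false) e false) (Function.update (Function.update w f false) e false) := by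
  simp only [K3_eq_KB]
  rw [st_two_closed_e ends o a₁ a₂ a₃ b he hou hef ho1 ho2 ho3 hob hy,
    st_two_closed_e ends o a₁ a₂ a₃ b he hou hef ho1 ho2 ho3 hob hw,
    st_two_closed_f ends o a₁ a₂ a₃ b hf hov hef ho1 ho2 ho3 hob hx]
  rw [KB_mixed13]
  push_cast
  ring

/-- `e` in copy `3`, `f` in copy `2`. -/
lemma K3_mixed32 {e f : E} {u v : V} (he : ends e = s(o, u)) (hf : ends f = s(o, v))
    (hou : o ≠ u) (hov : o ≠ v) (hef : e ≠ f) (ho1 : o ≠ a₁) (ho2 : o ≠ a₂) (ho3 : o ≠ a₃)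
    (hob : o ≠ b) {x y w : Config E}
    (hx : ∀ e', e' ≠ e → e' ≠ f → o ∈ ends e' → x e' = false)
    (hy : ∀ e', e' ≠ e → e' ≠ f → o ∈ ends e' → y e' = false)
    (hw : ∀ e', e' ≠ e → e' ≠ f → o ∈ ends e' → w e' = false) :
    (K3 ends o a₁ a₂ a₃ b (Function.update (Function.update x f false) e false) (Function.update (Function.update y f true) e false) (Function.update (Function.update w f false) e true) : R) =
      K3 ends o a₁ a₂ a₃ b (Function.update (Function.update x f false) e false) (Function.update (Function.update y f false) e false) (Function.update (Function.update w f false) e true) +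
      K3 ends o a₁ a₂ a₃ b (Function.update (Function.update x f false) e false) (Function.update (Function.update y f true) e false) (Function.update (Function.update w f false) e false) := by
  simp only [K3_eq_KB]
  rw [st_two_closed_e ends o a₁ a₂ a₃ b he hou hef ho1 ho2 ho3 hob hx,
    st_two_closed_e ends o a₁ a₂ a₃ b he hou hef ho1 ho2 ho3 hob hw,
    st_two_closed_f ends o a₁ a₂ a₃ b hf hov hef ho1 ho2 ho3 hob hy]
  rw [KB_mixed23]
  push_cast
  ring

end Mixed


end TypedRed

end CovForm

end Summit.Ventures.PercRepro2
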